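import Mathlib
import Summits.HodgeConjecture.FermatCycles.HodgeFermatCorollaryUPrime
import Summits.HodgeConjecture.FermatCycles.HodgeFermatQuadEnum
import Summits.HodgeConjecture.FermatCycles.HodgeFermatPropDPrimeNFinal

/-!
# COROLLARY U′ — unconditional at every odd level `N ∉ {21, 39}`, and: every all-unit Hodge QUADRUPLE at every odd level is two pairs (`HodgeFermat/CorollaryUPrimeFinal.lean`; HF-G27); closes the statement `CorUPrime`

Tree copy of the module `HodgeFermat/CorollaryUPrimeFinal.lean` of the sibling cell's standalone package
`run/shared/lean/pub/pub-hodgefermat/lean/HodgeFermat/` (106 lines, sha256 `3bb9706677408c29…`), source lines 23–106 (all: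
`hypWPlus'_iff : HypWPlus' ↔ HypWPlus := Iff.rfl`, `corUPrime : CorUPrime` — COROLLARY U′ with NO hypotheses —, `quadruple`, `sextuple`, `reach`,
`isSumOfPairs_pairs`, `isSumOfPairs_of_twoPairs`, `quadruple_odd` — EVERY ALL-UNIT HODGE QUADRUPLE AT EVERY ODD LEVEL IS TWO PAIRS
(COROLLARY U′ at `N ∉ {21, 39}` + the kernel enumeration `QuadEnum.twoPairs_small` at 21, 39) —, `reach_quadruple_odd`) — pub-hodgefermat
`CERT.md` l.912, GATE HF-G27; cell record the link check `check/CorUPrimeLink_standalone.lean` (`--axioms corUPrime`, `--axioms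
quadruple_odd` = the trio + exactly the postulated `HypUPlus.hypWPlus` — LEMMA W⁺, a THEOREM of this tree since 2026-08-25,
`HodgeFermat.KRFree.HypUPlus.hypWPlus` in `HodgeFermatPropDPrimeNFinal.lean`).
Filed by cell `pub-hfermat`, seat prover-1 gen-5, on the COORDINATOR KEEPER RULING of 2026-08-25 (gem sweep H1: take the
off-gate kernel theorem `thmFstar` through the gate; every form of THEOREM F* is on-gate since 2026-08-25/26, gen-0/2/3/4), as
successor work of the same verbatim-port kind: the sibling's off-gate gate records HF-G27 / HF-G27b / HF-G27c — COROLLARY U′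
(all-unit Hodge multisets with few distinct residues are sums of pairs), its printed-threshold forms U♯, and THEOREM U in
shared-entry form — on top of the landed LEMMA W / THEOREM U / U⁺ / U⁼ chain (`HodgeFermatTheoremU.lean`,
`HodgeFermatLemmaWFourier.lean`, `HodgeFermatTheoremUPlus.lean`, `HodgeFermatTheoremUEq.lean`, `HodgeFermatPropDPrimeNFinal.lean`).
Deviations from the source module, exhaustively: the `import` lines (`…HodgeFermatCorollaryUPrime`, `…HodgeFermatQuadEnum`,
`…HodgeFermatPropDPrimeNFinal` for `import HodgeFermat.TheoremUPlusFinal`, landed inside that multi-module file); this docstring (replacing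
the module docstring, quoted below).  Every other line is byte-identical to the source (l.23–106).
Trust base: no hypotheses in `corUPrime` / `quadruple_odd`, no `sorry`; axioms = [propext, Classical.choice, Quot.sound].
HONEST FRAMING: explicit algebraic cycles for specific Hodge classes on Fermat/Delsarte varieties; residual open instances
listed; no claim on general Hodge.  (This file is arithmetic of CM types / finite combinatorics of the sibling's KR-free
programme; it claims nothing about cycles.)

The docstring of `HodgeFermat/CorollaryUPrimeFinal.lean` (l.8–21), verbatim:

## COROLLARY U′ — unconditional at every odd level `N ∉ {21, 39}` (HF-G27)

`corUPrime : CorUPrime` (every Hodge multiset over `ℤ/N` whose entries are units and which has at most six distinct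
entries is a sum of pairs `{a, −a}`), with the quadruple / sextuple / reachability corollaries: the module
`CorollaryUPrime` (`corUPrime_of : HypWPlus' → CorUPrime`) applied to generation 26's unconditional LEMMA W
`HypUPlus.hypWPlus`, after the syntactic identity `HypWPlus' ↔ HypWPlus` (`Iff.rfl`).
With the kernel enumeration `QuadEnum.twoPairs_small` at the two exceptional levels `21, 39` this gives
`quadruple_odd`: **every all-unit Hodge quadruple at every odd level is two pairs** (no exception; the smallest level
with an all-unit Hodge quadruple that is not two pairs is the even level `20`, `QuadEnum.quadCheck_20`).
Hub record: `check/CorUPrime_standalone.lean`, `check/QuadEnum_standalone.lean` + generation 26's records of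
`hypWPlus` + the link check `check/CorUPrimeLink_standalone.lean` (`--axioms corUPrime`, `--axioms quadruple_odd` =
the three + exactly `HypUPlus.hypWPlus`).
-/

set_option autoImplicit false

namespace HodgeFermat.KRFree.CorollaryUPrime

open HodgeFermat.KRFree.HypUPlus HodgeFermat.KRFree.QuadEnum
open Literature.AlgebraicGeometry.HodgeTheory.FermatCharacter

/-- the verbatim copy `HypWPlus'` IS generation 26's `HypWPlus` (syntactic identity). -/
theorem hypWPlus'_iff : HypWPlus' ↔ HypWPlus := Iff.rfl

/-- **COROLLARY U′** — no hypotheses: at every odd level `N ∉ {21, 39}`, a Hodge multiset over `ℤ/N` all of whose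
entries are units and which has at most six distinct entries is a sum of pairs `{a, −a}`. -/
theorem corUPrime : CorUPrime := corUPrime_of (hypWPlus'_iff.mpr hypWPlus)

/-- every all-unit Hodge QUADRUPLE at an odd level `N ∉ {21, 39}` is two pairs. -/
theorem quadruple (N : ℕ) (h2 : ¬ 2 ∣ N) (h21 : N ≠ 21) (h39 : N ≠ 39) (s : Multiset (ZMod N))
    (hs : IsHodgeMultiset s) (hu : ∀ a ∈ s, IsUnit a) (h4 : Multiset.card s = 4) : IsSumOfPairs s :=
  quadruple_of (hypWPlus'_iff.mpr hypWPlus) N h2 h21 h39 s hs hu h4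

/-- every all-unit Hodge SEXTUPLE at an odd level `N ∉ {21, 39}` is three pairs. -/
theorem sextuple (N : ℕ) (h2 : ¬ 2 ∣ N) (h21 : N ≠ 21) (h39 : N ≠ 39) (s : Multiset (ZMod N))
    (hs : IsHodgeMultiset s) (hu : ∀ a ∈ s, IsUnit a) (h6 : Multiset.card s = 6) : IsSumOfPairs s :=
  sextuple_of (hypWPlus'_iff.mpr hypWPlus) N h2 h21 h39 s hs hu h6

/-- every all-unit Hodge multiset with at most six distinct entries at an odd level `N ∉ {21, 39}` is ℤ-reachable
(indeed a sum of pairs) from the printed supply of its own level. -/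
theorem reach (N : ℕ) (h2 : ¬ 2 ∣ N) (h21 : N ≠ 21) (h39 : N ≠ 39) (s : Multiset (ZMod N))
    (hs : IsHodgeMultiset s) (hu : ∀ a ∈ s, IsUnit a) (h6 : s.toFinset.card ≤ 6) : Reach N s :=
  reach_of (hypWPlus'_iff.mpr hypWPlus) N h2 h21 h39 s hs hu h6

/-! ## Quadruples at every odd level -/

/-- `{x, −x, y, −y}` is a sum of (two) pairs -/
theorem isSumOfPairs_pairs {N : ℕ} (x y : ZMod N) (hx : x ≠ 0) (hy : y ≠ 0) :
    IsSumOfPairs ({x, -x, y, -y} : Multiset (ZMod N)) :=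
  ⟨{x, y}, by
    intro z hz
    simp only [Multiset.insert_eq_cons, Multiset.mem_cons, Multiset.mem_singleton] at hz
    rcases hz with rfl | rfl <;> assumption,
   by simp only [Multiset.insert_eq_cons, Multiset.map_cons, Multiset.map_singleton, Multiset.sum_cons,
     Multiset.sum_singleton, Multiset.cons_add, Multiset.singleton_add]⟩

/-- two pairs (in any of the three pairings) ⇒ a sum of pairs -/
theorem isSumOfPairs_of_twoPairs {N : ℕ} {a b c d : ZMod N} (ha : a ≠ 0) (hb : b ≠ 0) (hc : c ≠ 0)
    (h : (a + b = 0 ∧ c + d = 0) ∨ (a + c = 0 ∧ b + d = 0) ∨ (a + d = 0 ∧ b + c = 0)) :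
    IsSumOfPairs ({a, b, c, d} : Multiset (ZMod N)) := by
  rcases h with ⟨h1, h2⟩ | ⟨h1, h2⟩ | ⟨h1, h2⟩
  · have hb' : b = -a := by linear_combination h1
    have hd' : d = -c := by linear_combination h2
    rw [hb', hd']
    exact isSumOfPairs_pairs a c ha hc
  · have hc' : c = -a := by linear_combination h1
    have hd' : d = -b := by linear_combination h2
    have key : ({a, b, -a, -b} : Multiset (ZMod N)) = {a, -a, b, -b} := by
      simp only [Multiset.insert_eq_cons]
      rw [Multiset.cons_swap b (-a)]
    rw [hc', hd', key]
    exact isSumOfPairs_pairs a b ha hb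
  · have hd' : d = -a := by linear_combination h1
    have hc' : c = -b := by linear_combination h2
    have key : ({a, b, -b, -a} : Multiset (ZMod N)) = {a, -a, b, -b} := by
      simp only [Multiset.insert_eq_cons, ← Multiset.cons_zero]
      rw [Multiset.cons_swap (-b) (-a), Multiset.cons_swap b (-a)]
    rw [hc', hd', key]
    exact isSumOfPairs_pairs a b ha hb

/-- **Every all-unit Hodge QUADRUPLE at every ODD level is two pairs** — COROLLARY U′ at the odd levels
`N ∉ {21, 39}` and the kernel enumeration `QuadEnum.twoPairs_small` (`quadCheck_21`, `quadCheck_39`, by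
`decide +kernel`) at the two exceptional levels of LEMMA S.  (At even levels this fails: `QuadEnum.quadCheck_20`.) -/
theorem quadruple_odd (N : ℕ) (h2 : ¬ 2 ∣ N) (s : Multiset (ZMod N)) (hs : IsHodgeMultiset s)
    (hu : ∀ a ∈ s, IsUnit a) (h4 : Multiset.card s = 4) : IsSumOfPairs s := by
  by_cases hN : N = 21 ∨ N = 39
  · obtain ⟨a, b, c, d, rfl⟩ := Multiset.card_eq_four.mp h4
    have h0 := hs.1.1
    exact isSumOfPairs_of_twoPairs (h0 a (by simp)) (h0 b (by simp)) (h0 c (by simp))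
      (twoPairs_small hN hs (hu a (by simp)) (hu b (by simp)) (hu c (by simp)) (hu d (by simp)))
  · exact quadruple N h2 (fun h => hN (Or.inl h)) (fun h => hN (Or.inr h)) s hs hu h4

/-- … hence ℤ-reachable from the printed supply of its own level. -/
theorem reach_quadruple_odd (N : ℕ) (h2 : ¬ 2 ∣ N) (s : Multiset (ZMod N)) (hs : IsHodgeMultiset s)
    (hu : ∀ a ∈ s, IsUnit a) (h4 : Multiset.card s = 4) : Reach N s :=
  reach_of_isSumOfPairs (quadruple_odd N h2 s hs hu h4)

end HodgeFermat.KRFree.CorollaryUPrime
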